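import Literature.NumberTheory.EllipticCurves.HuShuYin2019.SylvesterNineQuotientParametrization
import Literature.NumberTheory.EllipticCurves.HeckeOperatorsDiamondProofs
import HarnessLib

/-!
# Hu–Shu–Yin Prop. 2.1 (1), sequel: invariance of the degree-`6` parametrisation under HSY's whole level group
# `Γ = ⟨Γ₀(3⁵), W, A⟩`

Topic `NumberTheory/EllipticCurves/HuShuYin2019`; namespace `Literature.NumberTheory.EllipticCurves.HuShuYin2019`.
THEOREMS ONLY (no definition, no named fact, no instance; D-0026 debt 0).  Sequel of
`SylvesterNineQuotientParametrization.lean` (`IsS3Invariant`, the named fact `phi_s3Invariant_of_deg_eq_six`): combined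
with the tree's `Γ₀(243)`-invariance `Dt.φ_gamma0_smul` (the fact-predicate of `ModularCurve.lean`, = `φ_gamma0_smul_holds`
of the C9 fact `eichlerIntegral_gamma_smul`), `Dt.φ` is invariant under every element of the subgroup of `GL₂(ℚ)`
generated by `w₂₄₃`, `A` and `slToGLPos (Γ₀(243))` — HSY §2.1 «`Γ = GL₂(ℚ)⁺ ∩ U = ⟨Γ₀(3⁵), W, A⟩`», `X_Γ ≅ E₉`:
`Dt.φ` factors through `X_Γ`.  Seat `bsd-cm-k-ty1` (sixteenth seating), D816 SUMMON (G3); for the (W2-b)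
reductions of crux `stmt-BirchSwinnertonDyer-19804` (transport partners `γ · W Aⁱ · τ_n`, `γ ∈ Γ₀(243)`).  Nothing is
asserted about 19804; BSD is claimed for no curve.

## References
* [HuShuYin2019] Y. Hu, J. Shu, H. Yin, Trans. AMS 372 (2019) (arXiv:1708.05266), §2.1 (p. 5 L29), Prop. 2.1 (1).
-/

noncomputable section

open UpperHalfPlane
open scoped MatrixGroups

namespace Literature.NumberTheory.EllipticCurves.HuShuYin2019

open Literature.NumberTheory.EllipticCurves.ModularForms
open Literature.NumberTheory.EllipticCurves.ModularForms.ModularParametrizationData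

section Gamma

variable {Dt : ModularParametrizationData (⟨0, 0, 1, 0, -1⟩ : WeierstrassCurve ℚ) 243}

/-- `γ ∈ SL(2, ℤ)` acts on `ℍ` through `glCast (slToGLPos γ)` (the tree's `glCast_slToGLPos`: this is Mathlib's
`mapGL ℝ γ`). [folklore] -/
private theorem glCast_slToGLPos_smul (γ : SL(2, ℤ)) (τ : ℍ) :
    glCast (slToGLPos γ : GL (Fin 2) ℚ) • τ = γ • τ := by
  rw [glCast_slToGLPos]
  rfl

/-- **Invariance of `Dt.φ` under HSY's level group `Γ = ⟨Γ₀(3⁵), W, A⟩ ≤ GL₂(ℚ)⁺`**: given the `Γ₀(243)`-invariance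
of `Dt.φ` (the tree's fact `Dt.φ_gamma0_smul`, = `φ_gamma0_smul_holds` of the C9 fact `eichlerIntegral_gamma_smul`)
and `IsS3Invariant Dt`, `Dt.φ (g • τ) = Dt.φ τ` for every `g` in the subgroup of `GL₂(ℚ)` generated by `w₂₄₃`, `A`
and the image `slToGLPos (Γ₀(243))` — i.e. `Dt.φ` factors through `X_Γ = Γ\ℍ*` (HSY §2.1: «`Γ = GL₂(ℚ)⁺ ∩ U =
⟨Γ₀(3⁵), W, A⟩`», `X_Γ ≅ E₉`). [cite: HuShuYin2019, §2.1 (p. 5 L29) and Prop. 2.1 (1)] -/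
theorem IsS3Invariant.smul_of_mem_closure_gamma0 (h : IsS3Invariant Dt) (hΓ : Dt.φ_gamma0_smul) {g : GL (Fin 2) ℚ}
    (hg : g ∈ Subgroup.closure (({(frickeGL 243 : GL (Fin 2) ℚ), hsyA} : Set (GL (Fin 2) ℚ)) ∪
      (fun γ : CongruenceSubgroup.Gamma0 243 ↦ (slToGLPos (γ : SL(2, ℤ)) : GL (Fin 2) ℚ)) '' Set.univ))
    (τ : ℍ) : Dt.φ (glCast g • τ) = Dt.φ τ := by
  induction hg using Subgroup.closure_induction generalizing τ with
  | mem x hx =>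
    rcases hx with hx | ⟨γ, -, rfl⟩
    · rcases hx with rfl | rfl
      · exact h.frickeGL_smul τ
      · exact h.hsyA_smul τ
    · rw [glCast_slToGLPos_smul, ← Subgroup.smul_def]
      exact hΓ γ τ
  | one => simp
  | mul x y _ _ hx hy => rw [show glCast (x * y) = glCast x * glCast y from map_mul _ x y, mul_smul, hx, hy]
  | inv x _ hx =>
    have h' := hx ((glCast x)⁻¹ • τ)
    rw [smul_inv_smul] at h'
    rw [show glCast x⁻¹ = (glCast x)⁻¹ from map_inv _ x]
    exact h'.symm

/-- The same for a degree-`6` datum, from the named fact. [cite: HuShuYin2019, Prop. 2.1 (1)] -/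
theorem phi_s3Invariant_of_deg_eq_six.smul_of_mem_closure_gamma0 (hF : phi_s3Invariant_of_deg_eq_six)
    (Dt : ModularParametrizationData (⟨0, 0, 1, 0, -1⟩ : WeierstrassCurve ℚ) 243) (hdeg : Dt.deg = 6)
    (hΓ : Dt.φ_gamma0_smul) {g : GL (Fin 2) ℚ}
    (hg : g ∈ Subgroup.closure (({(frickeGL 243 : GL (Fin 2) ℚ), hsyA} : Set (GL (Fin 2) ℚ)) ∪
      (fun γ : CongruenceSubgroup.Gamma0 243 ↦ (slToGLPos (γ : SL(2, ℤ)) : GL (Fin 2) ℚ)) '' Set.univ))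
    (τ : ℍ) : Dt.φ (glCast g • τ) = Dt.φ τ :=
  (hF Dt hdeg).smul_of_mem_closure_gamma0 hΓ hg τ

end Gamma

end Literature.NumberTheory.EllipticCurves.HuShuYin2019

end
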